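import Summits.QuantumFields.YangMills.Theorems.FluctuationComparisonRegPrIntLS2BetaContractingSupStart
import HarnessLib

/-!
# The TWO-PROFILE sup recursion (size `s`, transverse variation `v`) with a start: the bootstrap and its thresholds —
# what way-out (a) of the (L♭) road asks of a `(s, v)` step once the refined (F3) letter has replaced `C₂·s²` by `σΔ + Δ² + σ³`

Cell `ym3-torus` (rung R3 = continuum `SU(2)` Yang–Mills on the three-torus — NOT d = 4, NOT infinite volume, NOT a mass gap, NOT Clay).
Width seat «width 21» `ym3-torus-px21` (gen 23); `--kind proof --supports stmt-QuantumFields-20520 --as helper`, count-neutral, DEFINITION-FREE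
(0 `def`, 0 `instance`, 0 `notation`, 0 `sorry`, default heartbeats).  Mathlib-only real-sequence algebra next to px16 g20's ✓`…S2BetaContractingSupRecursion`
and px12 g24's ✓`…S2BetaContractingSupStart` (the ONE-profile editions with the quadratic step `r₀·s + ρ + C₂·s²`).

WHY (UV3-NODE §84∕§86.5; px12 g24 14:42:08Z RISK; px8 g24 ✓`…SmallBondGaugeToronObstruction`; this seat's ✓`…SU2FourFactorSecondOrder` ∕ `…WhitneyHatLiftCurvatureSecondOrder`).
The one-profile bootstrap needs the START below `M ≈ (1 − r₀)∕(2C₂) ≈ 10⁻²`, under the toron floor of small volumes.  The refined (F3) letter has NO `σ²`: its junk is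
`F`-class, `σΔ`, `Δ²`, `σ³` with `Δ` a (transverse parallel) VARIATION of the coarser level — so the natural recursion carries a second profile `v` (torons: `v = 0`):
    `s t ≤ r₀·s (t+1) + ρ t + C₃·s (t+1)³ + C_sv·s (t+1)·v (t+1) + C_vv·v (t+1)²`,
    `v t ≤ r₁·v (t+1) + ρ′ t + D₃·s (t+1)³ + D_sv·s (t+1)·v (t+1) + D_vv·v (t+1)²`.
This file is the bookkeeping ONLY: ★★`sup_bootstrap_two_profile` (downward induction: if the start `(s m, v m) ≤ (M, N)` and the two CEILING inequalities
`r₀M + Sρ + C₃M³ + C_sv·M·N + C_vv·N² ≤ M`, `r₁N + Sρ′ + D₃M³ + D_sv·M·N + D_vv·N² ≤ N` hold, every level stays `≤ (M, N)`), ★`ceilings_of_quarters` (eight quarter-conditions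
imply the two ceilings) and ★★`sup_bootstrap_two_profile_quarters` (both in one).  READING (the located condition, numbers not adjectives): the `s`-ceiling is CUBIC in `M`
(`C₃M² ≤ (1 − r₀)∕4` — `M ≈ 0.09` at `C₃ ≈ 52`, `r₀ = 1∕5`) but the `v`-ceiling needs `D_sv·M ≤ (1 − r₁)∕4`: way-out (a) relaxes the start threshold EXACTLY when the cross
coefficient `D_sv` of the VARIATION step is `O(1)` — with the crude «variation of a correction ≤ 2 × its size» one gets `D_sv ≈ 2·(πN_P L⁻²)·20 ≈ 120` (no gain over `C₂`);
a lattice-Bianchi count of the correction's variation (a strip of `≈ L` fine plaquettes + size²) would give `D_sv ≈ 20π∕(2L) ≈ 6`.  That count is NOT done here.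

HONEST SCOPE.  Elementary inequalities; nothing of Bałaban's analysis is asserted ([Balaban1985RegularSpaces] (1.29) p.81: the printed small-field spaces carry size AND
derivative bounds — the analogue of `(s, v)`); the suppliers of the two steps (the refined lift letter's docking, the variation step, its `D_sv`), the datum's small-variation
gauge, (L♭), S2β, crux 20520 and `YM3TorusSU2` are NOT proved; no registered stub is closed; rung R3 = SU(2) YM₃ on T³ — NOT d = 4, NOT infinite volume, NOT a mass gap,
NOT Clay; the Yang–Mills mass gap is NOT proved.  References: T. Bałaban, CMP **99** (1985) 75–102 [Balaban1985RegularSpaces]; CMP **109** (1987) 249–301 [Balaban1987RG1].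
-/

set_option autoImplicit false

namespace Summit.QuantumFields.YangMills.Theorems.FluctuationComparisonRegPrIntLS2BetaContractingSupVarStart

open Finset
open Summit.QuantumFields.YangMills.Theorems.FluctuationComparisonRegPrIntLS2BetaContractingSupRecursion (le_of_sum_le_of_nonneg)

/-- ★★ **THE TWO-PROFILE BOOTSTRAP WITH A START**: non-negative profiles `s, v` and junk `ρ, ρ′` (`Σ_{t<m} ρ ≤ Sρ`, `Σ_{t<m} ρ′ ≤ Sρ′`), the guarded steps
`s (t+1) ≤ σ₀ → s t ≤ r₀·s (t+1) + ρ t + C₃·s (t+1)³ + C_sv·s (t+1)·v (t+1) + C_vv·v (t+1)²` and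
`s (t+1) ≤ σ₀ → v t ≤ r₁·v (t+1) + ρ′ t + D₃·s (t+1)³ + D_sv·s (t+1)·v (t+1) + D_vv·v (t+1)²` (`t < m`), non-negative coefficients, a start `s m ≤ M ≤ σ₀`,
`v m ≤ N`, and the two CEILINGS `r₀M + Sρ + C₃M³ + C_sv·M·N + C_vv·N² ≤ M`, `r₁N + Sρ′ + D₃M³ + D_sv·M·N + D_vv·N² ≤ N` ⟹ `s t ≤ M ∧ v t ≤ N` at every `t ≤ m`
(downward induction; the right-hand sides are monotone in `(s, v)` on `[0, M] × [0, N]`). [folklore] -/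
theorem sup_bootstrap_two_profile (s v ρ ρ' : ℕ → ℝ) (m : ℕ) (r₀ r₁ C₃ Csv Cvv D₃ Dsv Dvv σ₀ M N Sρ Sρ' : ℝ)
    (hs : s m ≤ M) (hv : v m ≤ N) (hsnn : ∀ t, 0 ≤ s t) (hvnn : ∀ t, 0 ≤ v t) (hρ : ∀ t, 0 ≤ ρ t) (hρ' : ∀ t, 0 ≤ ρ' t)
    (hSρ : ∑ t ∈ range m, ρ t ≤ Sρ) (hSρ' : ∑ t ∈ range m, ρ' t ≤ Sρ')
    (hstep : ∀ t, t < m → s (t + 1) ≤ σ₀ →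
      s t ≤ r₀ * s (t + 1) + ρ t + C₃ * s (t + 1) ^ 3 + Csv * s (t + 1) * v (t + 1) + Cvv * v (t + 1) ^ 2)
    (hstep' : ∀ t, t < m → s (t + 1) ≤ σ₀ →
      v t ≤ r₁ * v (t + 1) + ρ' t + D₃ * s (t + 1) ^ 3 + Dsv * s (t + 1) * v (t + 1) + Dvv * v (t + 1) ^ 2)
    (hr0 : 0 ≤ r₀) (hr1 : 0 ≤ r₁) (hC₃ : 0 ≤ C₃) (hCsv : 0 ≤ Csv) (hCvv : 0 ≤ Cvv) (hD₃ : 0 ≤ D₃) (hDsv : 0 ≤ Dsv) (hDvv : 0 ≤ Dvv)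
    (hMσ : M ≤ σ₀)
    (hceil : r₀ * M + Sρ + C₃ * M ^ 3 + Csv * M * N + Cvv * N ^ 2 ≤ M)
    (hceil' : r₁ * N + Sρ' + D₃ * M ^ 3 + Dsv * M * N + Dvv * N ^ 2 ≤ N) :
    ∀ t, t ≤ m → s t ≤ M ∧ v t ≤ N := by
  have hM0 : 0 ≤ M := (hsnn m).trans hs
  have hN0 : 0 ≤ N := (hvnn m).trans hv
  suffices h : ∀ k, ∀ t, t + k = m → s t ≤ M ∧ v t ≤ N by
    intro t ht
    exact h (m - t) t (by omega)
  intro k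
  induction k with
  | zero =>
    intro t ht
    have htm : t = m := by omega
    rw [htm]
    exact ⟨hs, hv⟩
  | succ k ih =>
    intro t ht
    have ht' : t < m := by omega
    obtain ⟨hS, hV⟩ := ih (t + 1) (by omega)
    have hS0 : 0 ≤ s (t + 1) := hsnn (t + 1)
    have hV0 : 0 ≤ v (t + 1) := hvnn (t + 1)
    -- monotone pieces
    have h3 : s (t + 1) ^ 3 ≤ M ^ 3 := pow_le_pow_left₀ hS0 hS 3
    have hsv : s (t + 1) * v (t + 1) ≤ M * N := mul_le_mul hS hV hV0 hM0
    have hvv : v (t + 1) ^ 2 ≤ N ^ 2 := pow_le_pow_left₀ hV0 hV 2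
    have hρt : ρ t ≤ Sρ := le_of_sum_le_of_nonneg ρ m Sρ hρ hSρ t ht'
    have hρ't : ρ' t ≤ Sρ' := le_of_sum_le_of_nonneg ρ' m Sρ' hρ' hSρ' t ht'
    refine ⟨?_, ?_⟩
    · calc s t ≤ r₀ * s (t + 1) + ρ t + C₃ * s (t + 1) ^ 3 + Csv * s (t + 1) * v (t + 1) + Cvv * v (t + 1) ^ 2 :=
            hstep t ht' (hS.trans hMσ)
        _ ≤ r₀ * M + Sρ + C₃ * M ^ 3 + Csv * (M * N) + Cvv * N ^ 2 := by
            have e1 := mul_le_mul_of_nonneg_left hS hr0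
            have e2 := mul_le_mul_of_nonneg_left h3 hC₃
            have e3 := mul_le_mul_of_nonneg_left hsv hCsv
            have e4 := mul_le_mul_of_nonneg_left hvv hCvv
            rw [mul_assoc] 
            linarith
        _ ≤ M := by rw [← mul_assoc]; exact hceil
    · calc v t ≤ r₁ * v (t + 1) + ρ' t + D₃ * s (t + 1) ^ 3 + Dsv * s (t + 1) * v (t + 1) + Dvv * v (t + 1) ^ 2 :=
            hstep' t ht' (hS.trans hMσ)
        _ ≤ r₁ * N + Sρ' + D₃ * M ^ 3 + Dsv * (M * N) + Dvv * N ^ 2 := by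
            have e1 := mul_le_mul_of_nonneg_left hV hr1
            have e2 := mul_le_mul_of_nonneg_left h3 hD₃
            have e3 := mul_le_mul_of_nonneg_left hsv hDsv
            have e4 := mul_le_mul_of_nonneg_left hvv hDvv
            rw [mul_assoc]
            linarith
        _ ≤ N := by rw [← mul_assoc]; exact hceil'

/-- ★ **QUARTER CONDITIONS IMPLY THE CEILINGS**: `Sρ ≤ (1−r₀)M∕4`, `C₃M² ≤ (1−r₀)∕4`, `C_sv·N ≤ (1−r₀)∕4`, `C_vv·N² ≤ (1−r₀)M∕4` give the `s`-ceiling, and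
`Sρ′ ≤ (1−r₁)N∕4`, `D₃M³ ≤ (1−r₁)N∕4`, `D_sv·M ≤ (1−r₁)∕4`, `D_vv·N ≤ (1−r₁)∕4` give the `v`-ceiling (`M, N ≥ 0`).  READING: the `s`-threshold is `√((1−r₀)∕(4C₃))`
(CUBIC), the located extra condition is `D_sv·M ≤ (1−r₁)∕4` — the cross coefficient of the VARIATION step decides whether way-out (a) relaxes the start. [folklore] -/
theorem ceilings_of_quarters (r₀ r₁ C₃ Csv Cvv D₃ Dsv Dvv M N Sρ Sρ' : ℝ) (hM0 : 0 ≤ M) (hN0 : 0 ≤ N)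
    (h1 : Sρ ≤ (1 - r₀) / 4 * M) (h2 : C₃ * M ^ 2 ≤ (1 - r₀) / 4) (h3 : Csv * N ≤ (1 - r₀) / 4) (h4 : Cvv * N ^ 2 ≤ (1 - r₀) / 4 * M)
    (h1' : Sρ' ≤ (1 - r₁) / 4 * N) (h2' : D₃ * M ^ 3 ≤ (1 - r₁) / 4 * N) (h3' : Dsv * M ≤ (1 - r₁) / 4) (h4' : Dvv * N ≤ (1 - r₁) / 4) :
    r₀ * M + Sρ + C₃ * M ^ 3 + Csv * M * N + Cvv * N ^ 2 ≤ M ∧ r₁ * N + Sρ' + D₃ * M ^ 3 + Dsv * M * N + Dvv * N ^ 2 ≤ N := by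
  constructor
  · have e2 : C₃ * M ^ 3 ≤ (1 - r₀) / 4 * M := by
      rw [show C₃ * M ^ 3 = C₃ * M ^ 2 * M by ring]; exact mul_le_mul_of_nonneg_right h2 hM0
    have e3 : Csv * M * N ≤ (1 - r₀) / 4 * M := by
      rw [show Csv * M * N = Csv * N * M by ring]; exact mul_le_mul_of_nonneg_right h3 hM0
    linarith
  · have e3 : Dsv * M * N ≤ (1 - r₁) / 4 * N := mul_le_mul_of_nonneg_right h3' hN0
    have e4 : Dvv * N ^ 2 ≤ (1 - r₁) / 4 * N := by
      rw [show Dvv * N ^ 2 = Dvv * N * N by ring]; exact mul_le_mul_of_nonneg_right h4' hN0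
    linarith

/-- ★★ **THE TWO-PROFILE BOOTSTRAP FROM QUARTER CONDITIONS** (`sup_bootstrap_two_profile` ∘ `ceilings_of_quarters`): every level `s t ≤ M`, `v t ≤ N` (`t ≤ m`). [folklore] -/
theorem sup_bootstrap_two_profile_quarters (s v ρ ρ' : ℕ → ℝ) (m : ℕ) (r₀ r₁ C₃ Csv Cvv D₃ Dsv Dvv σ₀ M N Sρ Sρ' : ℝ)
    (hs : s m ≤ M) (hv : v m ≤ N) (hsnn : ∀ t, 0 ≤ s t) (hvnn : ∀ t, 0 ≤ v t) (hρ : ∀ t, 0 ≤ ρ t) (hρ' : ∀ t, 0 ≤ ρ' t)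
    (hSρ : ∑ t ∈ range m, ρ t ≤ Sρ) (hSρ' : ∑ t ∈ range m, ρ' t ≤ Sρ')
    (hstep : ∀ t, t < m → s (t + 1) ≤ σ₀ →
      s t ≤ r₀ * s (t + 1) + ρ t + C₃ * s (t + 1) ^ 3 + Csv * s (t + 1) * v (t + 1) + Cvv * v (t + 1) ^ 2)
    (hstep' : ∀ t, t < m → s (t + 1) ≤ σ₀ →
      v t ≤ r₁ * v (t + 1) + ρ' t + D₃ * s (t + 1) ^ 3 + Dsv * s (t + 1) * v (t + 1) + Dvv * v (t + 1) ^ 2)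
    (hr0 : 0 ≤ r₀) (hr1 : 0 ≤ r₁) (hC₃ : 0 ≤ C₃) (hCsv : 0 ≤ Csv) (hCvv : 0 ≤ Cvv) (hD₃ : 0 ≤ D₃) (hDsv : 0 ≤ Dsv) (hDvv : 0 ≤ Dvv)
    (hMσ : M ≤ σ₀)
    (h1 : Sρ ≤ (1 - r₀) / 4 * M) (h2 : C₃ * M ^ 2 ≤ (1 - r₀) / 4) (h3 : Csv * N ≤ (1 - r₀) / 4) (h4 : Cvv * N ^ 2 ≤ (1 - r₀) / 4 * M)
    (h1' : Sρ' ≤ (1 - r₁) / 4 * N) (h2' : D₃ * M ^ 3 ≤ (1 - r₁) / 4 * N) (h3' : Dsv * M ≤ (1 - r₁) / 4) (h4' : Dvv * N ≤ (1 - r₁) / 4) :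
    ∀ t, t ≤ m → s t ≤ M ∧ v t ≤ N := by
  have hM0 : 0 ≤ M := (hsnn m).trans hs
  have hN0 : 0 ≤ N := (hvnn m).trans hv
  obtain ⟨hc, hc'⟩ := ceilings_of_quarters r₀ r₁ C₃ Csv Cvv D₃ Dsv Dvv M N Sρ Sρ' hM0 hN0 h1 h2 h3 h4 h1' h2' h3' h4'
  exact sup_bootstrap_two_profile s v ρ ρ' m r₀ r₁ C₃ Csv Cvv D₃ Dsv Dvv σ₀ M N Sρ Sρ' hs hv hsnn hvnn hρ hρ' hSρ hSρ' hstep hstep'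
    hr0 hr1 hC₃ hCsv hCvv hD₃ hDsv hDvv hMσ hc hc'

end Summit.QuantumFields.YangMills.Theorems.FluctuationComparisonRegPrIntLS2BetaContractingSupVarStart
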